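/-
Copyright: the b2b-balaban T⁴-continuum CRUX team, row NE7b OWNER lineage `t4-ne7b-p1` (gen 118). Project licence.
-/
import Summits.QuantumFields.BalabanUV.T4Continuum.Spine.NE7b.SupTorusEffectiveActionGradient
import Summits.QuantumFields.BalabanUV.T4Continuum.Spine.NE7b.SupTorusFibreFluctuation

/-!
# THE FIBRE RESPONSE AS A MAP: at every fine torus field `φ` with the curvature floor `−λ ≤ u′(φ x)`, `λ < min(2,a)`, there is a
# CONTINUOUS LINEAR section `Dt` of the torus block mean (`Q′t(Dt k) = k`) whose linearised covector
# `⟨(At + u′(φ)·)(Dt k), –⟩` kills the block-average fibre — (98)'s fluctuation solve applied to the block lift and made linear by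
# uniqueness — and such a covector pairs like the block lift of its block mean (TEA's `hlin`, `vol = (n+1)^d`)
# (row NE7b, node U5c; (93) + (96) + (98) + TEA + TDF BY NAME; [folklore])

Cell `pub-balaban`, sub-cell `t4`, spine estimate NE7b (`T4WeightBudget.RelWeightBound`; the cell's OWN estimate — NOT PRINTED in
[Bałaban 1983–89], NOT PROVED).  Crux-route work under `Spine/NE7b/` by the row OWNER (`t4-ne7b-p1` gen 118) under FREEZE (0)'s
crux-prover clause, first half of gen 117's located item (a) «C¹ of the GLOBAL background map in the convex regime» (the derivative's
VALUE; the differentiability is `…SupTorusBackgroundDerivative`); NOTHING of Bałaban's is named as a Lean object, valued or asserted;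
no `T4Continuum/Support` leaf typed; no `def`, no notation (responses are quantified, not constructed); zero `sorry`.  Imports (BY
NAME): the OWNER's (96) `…SupTorusEffectiveActionGradient` (`exists_clm_blockLift`; through it (93) `blockLift_of_critical`, (89)
`torus_operator_form_coercive`, TEA `exists_clm_pairForm`, TDF `sum_blockLift_mul_eq_blockAvg`) and the OWNER's (98)
`…SupTorusFibreFluctuation` (`existsUnique_fibre_solution`; through it (90) `response_form_floor`).

WHY (located).  TEA ∕ HESS ∕ (90) take the response `Dt` of the background map as a LETTER (`HasFDerivAt σt Dt`, `Q′t∘Dt = 1`, the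
linearised fibre equation in pairing form `hlin`).  In the convex regime the response is determined by the field alone: (98) solves
the fibre equation uniquely at every field with a positive floor, so the block lift `M k` has exactly one fibre correction `h(k)` with
`S″(φ)(M k + h(k), κ) = 0` on `ker Q′t`; uniqueness makes `k ↦ h(k)` additive and homogeneous, finite dimension makes it continuous.
On the torus a covector killing the fields with zero block means is the block lift of its own block mean ((93)), which is `hlin` with
`Mt k = Q′t((At + u′(φ)·)(Dt k))` and `vol = (n+1)^d` (TDF).

WHAT IS PROVED ([folklore]):
* §1 (TEA's level: finite carriers; ANY `At`, `u′`, `φ` with a positive floor `m·Σ h² ≤ Σ ((At h) x + u′(φ x)·h x)·h x`; ANY `Qt`)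
  `existsUnique_fibre_correction` ((98) in bilinear-letter form: `∃! h ∈ ker Qt`, `H (g₀ + h) κ = 0` on `ker Qt`),
  **`exists_fibre_response`** (for ANY continuous linear right inverse `M` of `Qt`: `∃ D` continuous linear, `Qt(D k) = k`,
  `H (D k) κ = 0` on `ker Qt`), `exists_clm_diag` (sitewise multiplication as a continuous linear map).
* §2 (the `Beta.Site` carriers, displayed actions) **`torus_exists_response`** (`−λ ≤ u′(φ x)` at every site, `λ < min(2,a)`:
  `∃ Dt`, `Q′t(Dt k) = k`, `Σ_x ((At(Dt k)) x + u′(φ x)·(Dt k) x)·κ x = 0` on the torus fibre; `At = Rf∘Aop∘Ef`, `Q′t = Rc∘Dop∘Ef`),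
  **`torus_response_pairing`** (fibre-killing ⟹ `Σ_x ((At(Dt k)) x + u′(φ x)·(Dt k) x)·h x = (n+1)^d·Σ_y (Mt k) y·(Q′t h) y` for
  ANY `Mt` with the displayed action — TEA's `hlin`).
* §3 toy.

HONEST (what this is NOT).  Finite-dimensional linear algebra + (93)∕(98) by name; the operator norm of `Dt` is whatever it is (no
mesh-∕volume-free bound here — (98) bounds the fibre correction in `ℓ²` by `(min(2,a) − λ)⁻¹`, the sup road's (63) is the weighted
`ℓ^∞` letter under two-sided curvature); one-sided curvature only; nothing about the measure; cubic periods; scalar skeleton, hard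
constraint, not the covariant operators ((A3), NC-NE7b-α UNRULED); nothing of Bałaban's.  BY-NAME EFFECT ON THE WALL: NONE.  NE7b
NOT PRINTED ∕ NOT PROVED; spine PROVED 0∕9; rung (B)+1 on a FINITE torus — NOT infinite volume, NOT the mass gap, NOT Clay.  HONEST
DEPENDENCY: continuum YM on T⁴ ⇐ BetaPertH ∧ nine spine estimates (0∕9 proved); BetaPertH ⇐ (D1) ∧ (D4) ∧ CAP+tail; G-an2-4 gates
asym, D1 and NE2∕3∕4.
-/

set_option autoImplicit false

noncomputable section

namespace Summit.QuantumFields.BalabanUV.T4Continuum.NE7b.SupTorusFibreResponse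

open Set Function
open scoped ENNReal
open Literature.MathematicalPhysics.QuantumFieldTheory.Balaban1983to89
open B6QGQLower276 (X blk B side AX)
open B5Hk103ScalarZd (nbhd)
open Beta (Site siteOf windowMap)
open SupTorusDirichletForm (sum_blockLift_mul_eq_blockAvg)
open SupTorusDirichletFormCoercive (torus_operator_form_coercive)
open SupTorusEffectiveAction (exists_clm_pairForm)
open SupTorusActionMinimiser (blockLift_of_critical)
open SupTorusEffectiveActionHessianFloor (response_form_floor)
open SupTorusFibreFluctuation (existsUnique_fibre_solution)
open SupTorusEffectiveActionGradient (exists_clm_blockLift)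

variable {d : ℕ}

/-! ## §1. TEA's level: the fibre response exists as a continuous linear map -/

section Generic

variable {ι κ : Type*} [Fintype ι] [Fintype κ]
omit [Fintype κ] in
/-- **THE FIBRE CORRECTION, BILINEAR-LETTER FORM** ((98) `existsUnique_fibre_solution` read through TEA's pairing form `H`): with a
positive floor `m·Σ h² ≤ Σ ((At h) x + u′(φ x)·h x)·h x`, for every `g₀` there is EXACTLY ONE `h ∈ ker Qt` with `H (g₀ + h) κ = 0`
for all `κ ∈ ker Qt`. [folklore] -/
theorem existsUnique_fibre_correction (At : (ι → ℝ) →L[ℝ] (ι → ℝ)) {u' : ℝ → ℝ} {φ : ι → ℝ} {m : ℝ} (hm : 0 < m)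
    (hfl : ∀ h : ι → ℝ, m * ∑ x, h x ^ 2 ≤ ∑ x, (At h x + u' (φ x) * h x) * h x) (Qt : (ι → ℝ) →L[ℝ] (κ → ℝ))
    {H : (ι → ℝ) →L[ℝ] (ι → ℝ) →L[ℝ] ℝ} (hH : ∀ k k' : ι → ℝ, H k k' = ∑ x, (At k x + u' (φ x) * k x) * k' x)
    (g₀ : ι → ℝ) :
    ∃! h : ι → ℝ, Qt h = 0 ∧ ∀ κ' : ι → ℝ, Qt κ' = 0 → H (g₀ + h) κ' = 0 := by
  obtain ⟨h, ⟨hker, hsolves⟩, huniq⟩ :=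
    existsUnique_fibre_solution At hm hfl (LinearMap.ker Qt.toLinearMap) (fun x => -(At g₀ x + u' (φ x) * g₀ x))
  have hneg : ∀ κ' : ι → ℝ, ∑ x, (-(At g₀ x + u' (φ x) * g₀ x)) * κ' x = -∑ x, (At g₀ x + u' (φ x) * g₀ x) * κ' x :=
    fun κ' => by
    rw [← Finset.sum_neg_distrib]
    exact Finset.sum_congr rfl fun x _ => by ring
  have key : ∀ h κ' : ι → ℝ,
      (∑ x, (At h x + u' (φ x) * h x) * κ' x = ∑ x, (-(At g₀ x + u' (φ x) * g₀ x)) * κ' x) ↔ H (g₀ + h) κ' = 0 :=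
    fun h κ' => by
    rw [hneg, map_add, add_apply, hH, hH, eq_neg_iff_add_eq_zero, add_comm]
  have hmem : ∀ κ' : ι → ℝ, Qt κ' = 0 ↔ κ' ∈ LinearMap.ker Qt.toLinearMap := fun κ' => by
    rw [LinearMap.mem_ker, ContinuousLinearMap.coe_coe]
  refine ⟨h, ⟨((hmem h).2 hker), fun κ' hκ' => (key h κ').1 (hsolves κ' ((hmem κ').1 hκ'))⟩, fun h' hh' => ?_⟩
  exact huniq h' ⟨(hmem h').1 hh'.1, fun κ' hκ' => (key h' κ').2 (hh'.2 κ' ((hmem κ').2 hκ'))⟩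

/-- **THE FIBRE RESPONSE EXISTS** (finite dimension, positive floor): for ANY `Qt` with a continuous linear right inverse `M` there is
a continuous linear `D` with `Qt (D k) = k` and `H (D k) κ = 0` for every `κ ∈ ker Qt` — the block lift corrected on the fibre, linear
by uniqueness of the correction. [folklore] -/
theorem exists_fibre_response (At : (ι → ℝ) →L[ℝ] (ι → ℝ)) {u' : ℝ → ℝ} {φ : ι → ℝ} {m : ℝ} (hm : 0 < m)
    (hfl : ∀ h : ι → ℝ, m * ∑ x, h x ^ 2 ≤ ∑ x, (At h x + u' (φ x) * h x) * h x) (Qt : (ι → ℝ) →L[ℝ] (κ → ℝ))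
    (M : (κ → ℝ) →L[ℝ] (ι → ℝ)) (hM : ∀ k : κ → ℝ, Qt (M k) = k)
    {H : (ι → ℝ) →L[ℝ] (ι → ℝ) →L[ℝ] ℝ} (hH : ∀ k k' : ι → ℝ, H k k' = ∑ x, (At k x + u' (φ x) * k x) * k' x) :
    ∃ D : (κ → ℝ) →L[ℝ] (ι → ℝ), (∀ k : κ → ℝ, Qt (D k) = k) ∧
      ∀ (k : κ → ℝ) (κ' : ι → ℝ), Qt κ' = 0 → H (D k) κ' = 0 := by
  choose h hh using fun k : κ → ℝ => existsUnique_fibre_correction At hm hfl Qt hH (M k)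
  -- linearity of the correction by uniqueness
  have hadd : ∀ k k' : κ → ℝ, h (k + k') = h k + h k' := fun k k' => by
    refine ((hh (k + k')).2 (h k + h k') ⟨?_, fun κ' hκ' => ?_⟩).symm
    · rw [map_add, (hh k).1.1, (hh k').1.1, add_zero]
    · have e : M (k + k') + (h k + h k') = (M k + h k) + (M k' + h k') := by rw [map_add]; abel
      rw [e, map_add, add_apply, (hh k).1.2 κ' hκ', (hh k').1.2 κ' hκ', add_zero]
  have hsmul : ∀ (c : ℝ) (k : κ → ℝ), h (c • k) = c • h k := fun c k => by
    refine ((hh (c • k)).2 (c • h k) ⟨?_, fun κ' hκ' => ?_⟩).symm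
    · rw [map_smul, (hh k).1.1, smul_zero]
    · have e : M (c • k) + c • h k = c • (M k + h k) := by rw [map_smul, smul_add]
      rw [e, map_smul, smul_apply, (hh k).1.2 κ' hκ', smul_zero]
  let Dl : (κ → ℝ) →ₗ[ℝ] (ι → ℝ) :=
    { toFun := fun k => M k + h k
      map_add' := fun k k' => by
        simp only [map_add, hadd]
        abel
      map_smul' := fun c k => by
        simp only [map_smul, hsmul, RingHom.id_apply, smul_add] }
  refine ⟨LinearMap.toContinuousLinearMap Dl, fun k => ?_, fun k κ' hκ' => ?_⟩
  · show Qt (M k + h k) = k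
    rw [map_add, hM, (hh k).1.1, add_zero]
  · show H (M k + h k) κ' = 0
    exact (hh k).1.2 κ' hκ'

omit [Fintype ι] in
/-- **SITEWISE MULTIPLICATION IS A CONTINUOUS LINEAR MAP**: `∃ N`, `(N h) x = g x·h x`. [folklore] -/
theorem exists_clm_diag (g : ι → ℝ) : ∃ N : (ι → ℝ) →L[ℝ] (ι → ℝ), ∀ (h : ι → ℝ) (x : ι), N h x = g x * h x :=
  ⟨ContinuousLinearMap.pi fun x : ι => g x • ContinuousLinearMap.proj (R := ℝ) (φ := fun _ : ι => ℝ) x, fun h x => by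
    simp only [ContinuousLinearMap.pi_apply, smul_apply, ContinuousLinearMap.proj_apply, smul_eq_mul]⟩

end Generic

/-! ## §2. The torus: the response at every fine field, and its pairing letter -/

section Torus

variable (n : ℕ) (a : ℝ) (s : ℕ) [NeZero s]
  {Dop Aop : lp (fun _ : X d => ℝ) ∞ →L[ℝ] lp (fun _ : X d => ℝ) ∞}
  (hD : ∀ (f : lp (fun _ : X d => ℝ) ∞) (y : X d), Dop f y = (((n : ℝ) + 1) ^ d)⁻¹ * ∑ p ∈ B n y, f p)
  (hA : ∀ (f : lp (fun _ : X d => ℝ) ∞) (p : X d), Aop f p = ∑ r ∈ nbhd n p, AX n a p r * f r)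
  {Ef : (Site d ((n + 1) * s) → ℝ) →L[ℝ] lp (fun _ : X d => ℝ) ∞}
  (hEf : ∀ (g : Site d ((n + 1) * s) → ℝ) (q : X d), Ef g q = g (siteOf d ((n + 1) * s) q))
  {Rf : lp (fun _ : X d => ℝ) ∞ →L[ℝ] (Site d ((n + 1) * s) → ℝ)}
  (hRf : ∀ (h : lp (fun _ : X d => ℝ) ∞) (x : Site d ((n + 1) * s)), Rf h x = h (windowMap d ((n + 1) * s) x))
  {Rc : lp (fun _ : X d => ℝ) ∞ →L[ℝ] (Site d s → ℝ)}
  (hRc : ∀ (h : lp (fun _ : X d => ℝ) ∞) (x : Site d s), Rc h x = h (windowMap d s x))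

include hD hA hEf hRf hRc in
/-- **THE TORUS RESPONSE EXISTS AT EVERY FINE FIELD WITH THE CURVATURE FLOOR**: `−λ ≤ u′(φ x)` at every fine torus site, `λ < min(2,a)`
⟹ `∃ Dt`, `Q′t (Dt k) = k` and `Σ_x ((At(Dt k)) x + u′(φ x)·(Dt k) x)·κ x = 0` for every torus field `κ` with zero block means
(`At = Rf∘Aop∘Ef`, `Q′t = Rc∘Dop∘Ef`). [folklore] -/
theorem torus_exists_response {u' : ℝ → ℝ} {lam : ℝ} {φ : Site d ((n + 1) * s) → ℝ} (hu'φ : ∀ x, -lam ≤ u' (φ x))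
    (hγ : lam < min 2 a) :
    ∃ Dt : (Site d s → ℝ) →L[ℝ] (Site d ((n + 1) * s) → ℝ),
      (∀ k : Site d s → ℝ, ((Rc.comp Dop).comp Ef) (Dt k) = k) ∧
      ∀ (k : Site d s → ℝ) (κ' : Site d ((n + 1) * s) → ℝ), ((Rc.comp Dop).comp Ef) κ' = 0 →
        ∑ x, (((Rf.comp Aop).comp Ef) (Dt k) x + u' (φ x) * Dt k x) * κ' x = 0 := by
  obtain ⟨M, -, hM⟩ := exists_clm_blockLift n s hD hEf hRc
  obtain ⟨H, hH⟩ := exists_clm_pairForm ((Rf.comp Aop).comp Ef) (fun x => u' (φ x))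
  have hfl := response_form_floor ((Rf.comp Aop).comp Ef) (torus_operator_form_coercive n a s hA hEf hRf) hu'φ
  obtain ⟨D, hDQ, hDlin⟩ := exists_fibre_response ((Rf.comp Aop).comp Ef) (sub_pos.2 hγ) hfl ((Rc.comp Dop).comp Ef) M hM hH
  exact ⟨D, hDQ, fun k κ' hκ' => by rw [← hH]; exact hDlin k κ' hκ'⟩

include hD hEf hRc in
/-- **A LINEARISED COVECTOR KILLING THE TORUS FIBRE PAIRS LIKE THE BLOCK LIFT OF ITS BLOCK MEAN** (TEA's `hlin`, `vol = (n+1)^d`): if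
for every `k` the covector `x ↦ (At(Dt k)) x + u′(φ x)·(Dt k) x` kills the torus fields with zero block means, then for ANY `Mt` with
the action `(Mt k) y = Q′t((At + u′(φ)·)(Dt k)) y` and all `k, h`:
`Σ_x ((At(Dt k)) x + u′(φ x)·(Dt k) x)·h x = (n+1)^d·Σ_y (Mt k) y·(Q′t h) y`. [folklore] -/
theorem torus_response_pairing {At : (Site d ((n + 1) * s) → ℝ) →L[ℝ] (Site d ((n + 1) * s) → ℝ)} {u' : ℝ → ℝ}
    {φ : Site d ((n + 1) * s) → ℝ} {Dt : (Site d s → ℝ) →L[ℝ] (Site d ((n + 1) * s) → ℝ)}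
    (hDlin : ∀ (k : Site d s → ℝ) (κ' : Site d ((n + 1) * s) → ℝ), ((Rc.comp Dop).comp Ef) κ' = 0 →
      ∑ x, (At (Dt k) x + u' (φ x) * Dt k x) * κ' x = 0)
    {Mt : (Site d s → ℝ) →L[ℝ] (Site d s → ℝ)}
    (hMt : ∀ (k : Site d s → ℝ) (y : Site d s),
      Mt k y = ((Rc.comp Dop).comp Ef) (fun x => At (Dt k) x + u' (φ x) * Dt k x) y)
    (k : Site d s → ℝ) (h : Site d ((n + 1) * s) → ℝ) :
    ∑ x, (At (Dt k) x + u' (φ x) * Dt k x) * h x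
      = ((n : ℝ) + 1) ^ d * ∑ y, Mt k y * ((Rc.comp Dop).comp Ef) h y := by
  have hlift := blockLift_of_critical n s hD hEf hRc (fun x => At (Dt k) x + u' (φ x) * Dt k x) (hDlin k)
  have h1 : ∑ x, (At (Dt k) x + u' (φ x) * Dt k x) * h x
      = ∑ x, Mt k (siteOf d s (blk n (windowMap d ((n + 1) * s) x))) * h x :=
    Finset.sum_congr rfl fun x _ => by rw [hMt, ← hlift x]
  rw [h1, sum_blockLift_mul_eq_blockAvg n s hD hEf hRc (Mt k) h]
  simp only [ContinuousLinearMap.comp_apply]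

end Torus

/-! ## §3. Toy -/

/-- Toy (§1 `exists_clm_diag` on one site): multiplication by `2`. -/
example : ∃ N : (Unit → ℝ) →L[ℝ] (Unit → ℝ), ∀ (h : Unit → ℝ) (x : Unit), N h x = (fun _ => (2 : ℝ)) x * h x :=
  exists_clm_diag (ι := Unit) fun _ => (2 : ℝ)

end Summit.QuantumFields.BalabanUV.T4Continuum.NE7b.SupTorusFibreResponse

end
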